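import Mathlib
import Summits.AtomisticToContinuum.HydrodynamicLimit.Theorems.JParityClosureEvenStressEnskogShortFlightDeficitRung0
import Literature.MathematicalPhysics.KineticTheory.CollisionFluxMeanBound
import HarnessLib

/-!
# `KickFairRelEquilibriumMeso`, line `Sketch` — stub U at rung 0, part A: the MEAN of the collision sum
# of the forward-contact count under the homogeneous Gibbs law

Helper file (`--supports stmt-AtomisticToContinuum-15177`) of the line lead for the registered stub
`stub_shortFlightLG` (short flights are rare in the mean, uniformly in `N`), rung-0 case. The tail form
`Literature.MathematicalPhysics.KineticTheory.localGibbsLaw_fwdHitCollisionSum_ge_le` (file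
`Literature/MathematicalPhysics/KineticTheory/ShortFlightCount.lean`) bounds the PROBABILITY that the collision
sum `K_F` of the forward-contact count is large, by Markov AFTER a bound on a mean it passes through; a tail
`≤ K/η` does not give back the mean, so this file records the same computation ONE STEP EARLIER, in
domination form: every `f ≥ 0` dominated on the good set by
`K_F = Σ_{collisions (s,p,m), s ∈ [0,τ]} #{j' ∉ {p,m} : ‖reprSym((x_{j'} − x_p) + proj(t (v_{j'} − v_p)))‖ = ε, t ∈ (0,ℓ)}`
has `E_{G_N} f ≤ 256 τ ℓ (N+1)³ ε⁴ · E‖w − v‖²` (`localGibbsLaw_lintegral_le_of_le_fwdHitCollisionSum`; registered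
sub-goal form with all binders after the colon: `fwdHitCollisionSum_lintegral_le_rung0`).

Proof: verbatim the proof of the tail form with the abstract MEAN device
`lintegral_le_liminf_of_le_collisionSum` (`CollisionFluxMeanBound`) in place of the Markov device
`measure_collisionSum_ge_le_liminf`: along the backward free flight of duration `≤ h = τ/M` of a window the
forward tube of `p` of length `ℓ` stays inside the two-sided tube of length `ℓ + h`
(`exists_latticeVec_mem_twoSidedTube`), the three-label statics `measure_windowEvent_inter_tubeEvent_le`
bound one window by `128 ε⁴ h (ℓ + h) m₂` per label triple, and the mesh cancels (`M · τ/M = τ`,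
`h ≤ ℓ` eventually). The statics (`htriple`, `htube`, `hlift`) and the invariance `hstat` stay hypotheses, as
in the Literature file; part B discharges them at small reduced density.

References: C. Cercignani, R. Illner, M. Pulvirenti, *The Mathematical Theory of Dilute Gases* (1994),
App. 4.A; I. Gallagher, L. Saint-Raymond, B. Texier, *From Newton to Boltzmann* (2013), Prop. 4.1.1.
-/

noncomputable section

open MeasureTheory Set Filter Topology
open scoped ENNReal InnerProductSpace BigOperators Classical

namespace Summit.AtomisticToContinuum.HydrodynamicLimit.Theorems.KickFairRelEquilibriumMesoLine

open Literature.Analysis.FluidPDE Literature.Analysis.FunctionSpaces Literature.MathematicalPhysics.KineticTheory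

/-- **Mean bound for the collision sum of the forward-contact count (rung 0, domination form).**  For
`σ ≤ 1/2`, constant profiles `a, θ > 0`, `u`, a flow `Φ` of `N + 1` spheres of diameter `ε = hsDiameter σ N`
on `𝕋³` preserving the homogeneous Gibbs law (`hstat`), the three-label canonical bound `htriple`, swept
tubes `htube` and the lift inequality `hlift`: for `τ, ℓ > 0`, every `f ≥ 0` dominated on the good set by
`Σ_{collisions (s,p,m), s ∈ [0,τ]} #{j' ∉ {p,m} : ‖reprSym((x_{j'} − x_p) + proj(t (v_{j'} − v_p)))‖ = ε, t ∈ (0,ℓ)}`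
(positions and velocities read at the collision) has
`∫ f dG_N ≤ 256 τ ℓ (N+1)³ ε⁴ · ∫ ‖q.2 − q.1‖² d(N(u,θ) ⊗ N(u,θ))` (the mean the tail bound
`localGibbsLaw_fwdHitCollisionSum_ge_le` passes through; Cercignani–Illner–Pulvirenti 1994 App. 4.A).
[folklore] -/
theorem localGibbsLaw_lintegral_le_of_le_fwdHitCollisionSum {σ : ℝ} (hσ2 : σ ≤ 1 / 2) {a θ : ℝ}
    (ha : 0 < a) (hθ : 0 < θ) (u : V3) {N : ℕ}
    (Φ : HardSphereFlow (Torus.geometry (Fin 3)) (hsDiameter σ N) (N + 1))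
    (hstat : ∀ t : ℝ, MeasurePreserving (Φ.flow t) (localGibbsLaw σ (fun _ => a) (fun _ => u) (fun _ => θ) N Φ)
      (localGibbsLaw σ (fun _ => a) (fun _ => u) (fun _ => θ) N Φ))
    (htriple : ∀ i j k : Fin (N + 1), i ≠ j → i ≠ k → j ≠ k → ∀ T T' : Set T3, MeasurableSet T →
      MeasurableSet T' →
      posGibbsMeasure (fun _ : T3 => (1 : ℝ)) (hsDiameter σ N) (N + 1) {x | x j - x i ∈ T ∧ x k - x i ∈ T'} ≤
        8 * (volume T * volume T'))
    (htube : ∀ h : ℝ, 0 ≤ h → ∃ S : V3 → Set V3, MeasurableSet {q : V3 × V3 | q.1 ∈ S q.2} ∧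
      (∀ u, volume (S u) ≤ ENNReal.ofReal (4 * hsDiameter σ N ^ 2 * h * ‖u‖)) ∧
      ∀ (u r : V3) (s : ℝ), hsDiameter σ N ≤ ‖r‖ → s ∈ Icc 0 h → ‖r + s • u‖ = hsDiameter σ N → r ∈ S u)
    (hlift : ∀ B : Set V3, MeasurableSet B →
      volume {x : T3 | ∃ k : Fin 3 → ℤ, Torus.reprSym x + Torus.latticeVec k ∈ B} ≤ volume B)
    {τ : ℝ} (hτ : 0 < τ) {ℓ : ℝ} (hℓ : 0 < ℓ) (f : Config (N + 1) (Fin 3) T3 → ℝ≥0∞)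
    (hf : ∀ z ∈ Φ.good, f z ≤ ∑ᶠ s ∈ collisionTimes (Torus.geometry (Fin 3)) (hsDiameter σ N)
            (fun t => Φ.flow t z) ∩ Icc 0 τ,
          ∑ i : Fin (N + 1), ∑ j : Fin (N + 1),
            (if i ≠ j ∧ ‖(Torus.geometry (Fin 3)).sepVec (Φ.flow s z i).1 (Φ.flow s z j).1‖ = hsDiameter σ N
              then (∑ j' : Fin (N + 1), if j' ≠ i ∧ j' ≠ j ∧ ∃ t ∈ Ioo 0 ℓ,
                ‖Torus.reprSym (((Φ.flow s z j').1 - (Φ.flow s z i).1) +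
                  Torus.proj (t • ((Φ.flow s z j').2 - (Φ.flow s z i).2)))‖ = hsDiameter σ N
                then (1 : ℝ≥0∞) else 0) else 0)) :
    ∫⁻ z, f z ∂(localGibbsLaw σ (fun _ => a) (fun _ => u) (fun _ => θ) N Φ) ≤
      ENNReal.ofReal (256 * τ * ℓ * ((N + 1 : ℕ) : ℝ) ^ 3 * hsDiameter σ N ^ 4) *
        ∫⁻ q, ENNReal.ofReal (‖q.2 - q.1‖ ^ 2) ∂((gaussMeasure u θ).prod (gaussMeasure u θ)) := by
  classical
  -- adapted from `localGibbsLaw_fwdHitCollisionSum_ge_le` (`ShortFlightCount`): Markov ↦ mean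
  set P := localGibbsLaw σ (fun _ => a) (fun _ => u) (fun _ => θ) N Φ with hPdef
  have hP : P Φ.goodᶜ = 0 := by
    rw [hPdef, localGibbsLaw_eq]
    exact localGibbsMeasure_absolutelyContinuous σ _ _ _ N Φ Φ.measure_compl_good
  set m₂ := ∫⁻ q, ENNReal.ofReal (‖q.2 - q.1‖ ^ 2) ∂((gaussMeasure u θ).prod (gaussMeasure u θ)) with hm₂
  -- tube families: length `ℓ`, and length `τ / M` for every mesh
  obtain ⟨Sℓ, hSℓm, hSℓvol, hSℓ⟩ := htube ℓ hℓ.le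
  have hhM : ∀ M : ℕ, 0 ≤ τ / M := fun M => div_nonneg hτ.le (Nat.cast_nonneg M)
  choose Sh hShm hShvol hSh using fun M : ℕ => htube (τ / M) (hhM M)
  -- events, mark, majorants
  set E : ℕ → Fin (N + 1) → Fin (N + 1) → Set (Config (N + 1) (Fin 3) T3) := fun M p m =>
    {w | ∃ k : Fin 3 → ℤ, Torus.reprSym ((w m).1 - (w p).1) + Torus.latticeVec k ∈ Sh M ((w p).2 - (w m).2)}
    with hEdef
  set E' : ℕ → Fin (N + 1) → Fin (N + 1) → Set (Config (N + 1) (Fin 3) T3) := fun M p j' =>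
    {w | ∃ k : Fin 3 → ℤ, Torus.reprSym ((w j').1 - (w p).1) + Torus.latticeVec k ∈
      Sℓ ((w j').2 - (w p).2) ∪ Sh M ((w p).2 - (w j').2)} with hE'def
  set F : Config (N + 1) (Fin 3) T3 → Fin (N + 1) → Fin (N + 1) → ℝ≥0∞ := fun w p m =>
    ∑ j' : Fin (N + 1), if j' ≠ p ∧ j' ≠ m ∧ ∃ t ∈ Ioo 0 ℓ,
      ‖Torus.reprSym (((w j').1 - (w p).1) + Torus.proj (t • ((w j').2 - (w p).2)))‖ = (hsDiameter σ N)
      then (1 : ℝ≥0∞) else 0 with hFdef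
  set Ft : ℕ → Config (N + 1) (Fin 3) T3 → Fin (N + 1) → Fin (N + 1) → ℝ≥0∞ := fun M w p m =>
    ∑ j' : Fin (N + 1), if j' ≠ p ∧ j' ≠ m then (E M p m ∩ E' M p j').indicator 1 w else 0 with hFtdef
  -- measurability
  have hψm : ∀ (i j i' j'' : Fin (N + 1)) (k : Fin 3 → ℤ), Measurable fun w : Config (N + 1) (Fin 3) T3 =>
      (Torus.reprSym ((w i).1 - (w j).1) + Torus.latticeVec k, (w i').2 - (w j'').2) := by
    intro i j i' j'' k
    refine Measurable.prodMk ?_ ?_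
    · exact (Torus.measurable_reprSym.comp
        ((measurable_pi_apply i).fst.sub (measurable_pi_apply j).fst)).add_const _
    · exact (measurable_pi_apply i').snd.sub (measurable_pi_apply j'').snd
  have hEm : ∀ M p m, MeasurableSet (E M p m) := by
    intro M p m
    have h1 : E M p m = ⋃ k : Fin 3 → ℤ, (fun w : Config (N + 1) (Fin 3) T3 =>
        (Torus.reprSym ((w m).1 - (w p).1) + Torus.latticeVec k, (w p).2 - (w m).2)) ⁻¹'
          {q : V3 × V3 | q.1 ∈ Sh M q.2} := by
      ext w; simp only [hEdef, mem_setOf_eq, mem_iUnion, mem_preimage]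
    rw [h1]
    exact MeasurableSet.iUnion fun k => (hShm M).preimage (hψm m p p m k)
  have hE'm : ∀ M p j', MeasurableSet (E' M p j') := by
    intro M p j'
    have h2 : E' M p j' = ⋃ k : Fin 3 → ℤ, ((fun w : Config (N + 1) (Fin 3) T3 =>
          (Torus.reprSym ((w j').1 - (w p).1) + Torus.latticeVec k, (w j').2 - (w p).2)) ⁻¹'
            {q : V3 × V3 | q.1 ∈ Sℓ q.2} ∪
          (fun w : Config (N + 1) (Fin 3) T3 =>
            (Torus.reprSym ((w j').1 - (w p).1) + Torus.latticeVec k, (w p).2 - (w j').2)) ⁻¹'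
            {q : V3 × V3 | q.1 ∈ Sh M q.2}) := by
      ext w; simp only [hE'def, mem_setOf_eq, mem_iUnion, mem_preimage, mem_union]
    rw [h2]
    exact MeasurableSet.iUnion fun k => (hSℓm.preimage (hψm j' p j' p k)).union ((hShm M).preimage (hψm j' p p j' k))
  have hsm : ∀ M p m j', Measurable fun w : Config (N + 1) (Fin 3) T3 =>
      (if j' ≠ p ∧ j' ≠ m then (E M p m ∩ E' M p j').indicator 1 w else 0 : ℝ≥0∞) := by
    intro M p m j'
    by_cases hj : j' ≠ p ∧ j' ≠ m
    · simp only [if_pos hj]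
      exact measurable_one.indicator ((hEm M p m).inter (hE'm M p j'))
    · simp only [if_neg hj]
      exact measurable_const
  have hFtm : ∀ M p m, Measurable fun w => Ft M w p m := fun M p m =>
    Finset.measurable_sum _ fun j' _ => hsm M p m j'
  -- covering property of the window events
  have hEc : ∀ (M : ℕ) (p m : Fin (N + 1)), p ≠ m →
      ∀ w ∈ hardSphereDomain (Torus.geometry (Fin 3)) (N + 1) (hsDiameter σ N), ∀ t ∈ Icc 0 (τ / M),
      ‖(Torus.geometry (Fin 3)).sepVec ((freeFlight (Torus.geometry (Fin 3)) (-t) w p).1)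
        ((freeFlight (Torus.geometry (Fin 3)) (-t) w m).1)‖ = (hsDiameter σ N) → w ∈ E M p m := by
    intro M p m hpm w hw t ht hc
    have hc' : ‖(Torus.geometry (Fin 3)).sepVec ((freeFlight (Torus.geometry (Fin 3)) (-t) w m).1)
        ((freeFlight (Torus.geometry (Fin 3)) (-t) w p).1)‖ = (hsDiameter σ N) := by
      rw [Torus.norm_geometry_sepVec, Torus.euclidDist_comm, ← Torus.norm_geometry_sepVec]
      exact hc
    exact exists_latticeVec_add_mem_of_contact (hSh M) hw hpm.symm ht hc'
  -- the majorants dominate the mark along the window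
  have hFt : ∀ (M : ℕ) (p m : Fin (N + 1)), p ≠ m →
      ∀ w ∈ hardSphereDomain (Torus.geometry (Fin 3)) (N + 1) (hsDiameter σ N), ∀ t ∈ Icc 0 (τ / M),
      ‖(Torus.geometry (Fin 3)).sepVec ((freeFlight (Torus.geometry (Fin 3)) (-t) w p).1)
        ((freeFlight (Torus.geometry (Fin 3)) (-t) w m).1)‖ = (hsDiameter σ N) →
        F (freeFlight (Torus.geometry (Fin 3)) (-t) w) p m ≤ Ft M w p m := by
    intro M p m hpm w hw t ht hc
    refine Finset.sum_le_sum fun j' _ => ?_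
    by_cases hcond : j' ≠ p ∧ j' ≠ m ∧ ∃ t' ∈ Ioo 0 ℓ,
        ‖Torus.reprSym ((((freeFlight (Torus.geometry (Fin 3)) (-t) w) j').1 -
          ((freeFlight (Torus.geometry (Fin 3)) (-t) w) p).1) +
          Torus.proj (t' • (((freeFlight (Torus.geometry (Fin 3)) (-t) w) j').2 -
            ((freeFlight (Torus.geometry (Fin 3)) (-t) w) p).2)))‖ = (hsDiameter σ N)
    · obtain ⟨hj'p, hj'm, t', ht', hhit⟩ := hcond
      rw [if_pos ⟨hj'p, hj'm, t', ht', hhit⟩, if_pos ⟨hj'p, hj'm⟩]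
      have hmem : w ∈ E M p m ∩ E' M p j' :=
        ⟨hEc M p m hpm w hw t ht hc, exists_latticeVec_mem_twoSidedTube (hSh M) hSℓ hw hj'p ht ht' hhit⟩
      rw [indicator_of_mem hmem, Pi.one_apply]
    · rw [if_neg hcond]
      exact bot_le
  -- the abstract mean bound
  have hgen := lintegral_le_liminf_of_le_collisionSum Φ P hstat hP hτ F E hEm hEc Ft hFtm hFt f hf
  -- the mean of one window
  have hB : ∀ M : ℕ, 0 < M → τ / M ≤ ℓ → (M : ℝ≥0∞) * ∫⁻ w, ∑ p, ∑ m,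
      (if p ≠ m then (E M p m).indicator (fun w => Ft M w p m) w else 0) ∂P ≤
        ENNReal.ofReal (256 * τ * ℓ * ((N + 1 : ℕ) : ℝ) ^ 3 * (hsDiameter σ N) ^ 4) * m₂ := by
    intro M hM hMℓ
    have hM' : (0 : ℝ) < M := by exact_mod_cast hM
    set c : ℝ≥0∞ := ENNReal.ofReal (128 * (hsDiameter σ N) ^ 4 * (τ / M) * (ℓ + τ / M)) * m₂ with hc
    -- one ordered pair
    have hterm : ∀ p m : Fin (N + 1), p ≠ m →
        ∫⁻ w, (E M p m).indicator (fun w => Ft M w p m) w ∂P ≤ ((N + 1 : ℕ) : ℝ≥0∞) * c := by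
      intro p m hpm
      have hind : ∀ w, (E M p m).indicator (fun w => Ft M w p m) w =
          ∑ j' : Fin (N + 1), (if j' ≠ p ∧ j' ≠ m then (E M p m ∩ E' M p j').indicator 1 w else 0 : ℝ≥0∞) := by
        intro w
        by_cases hw : w ∈ E M p m
        · rw [indicator_of_mem hw]
        · rw [indicator_of_notMem hw]
          symm
          refine Finset.sum_eq_zero fun j' _ => ?_
          split_ifs
          · exact indicator_of_notMem (fun h => hw h.1) _
          · rfl
      calc ∫⁻ w, (E M p m).indicator (fun w => Ft M w p m) w ∂P
          = ∑ j' : Fin (N + 1), ∫⁻ w, (if j' ≠ p ∧ j' ≠ m then (E M p m ∩ E' M p j').indicator 1 w else 0 : ℝ≥0∞) ∂P := by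
            rw [← lintegral_finsetSum _ fun j' _ => hsm M p m j']
            exact lintegral_congr hind
        _ ≤ ∑ _j' : Fin (N + 1), c := by
            refine Finset.sum_le_sum fun j' _ => ?_
            by_cases hj : j' ≠ p ∧ j' ≠ m
            · simp only [if_pos hj]
              rw [lintegral_indicator_one ((hEm M p m).inter (hE'm M p j'))]
              exact measure_windowEvent_inter_tubeEvent_le hσ2 ha hθ u Φ hpm (Ne.symm hj.1)
                (htriple p m j' hpm (Ne.symm hj.1) (Ne.symm hj.2)) (hhM M) hℓ.le (hShm M) hSℓm (hShvol M) hSℓvol hlift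
            · simp only [if_neg hj, lintegral_const, zero_mul]
              exact bot_le
        _ = ((N + 1 : ℕ) : ℝ≥0∞) * c := by
            rw [Finset.sum_const, Finset.card_univ, Fintype.card_fin, nsmul_eq_mul]
    have hmeas : ∀ p m : Fin (N + 1), Measurable fun w : Config (N + 1) (Fin 3) T3 =>
        (if p ≠ m then (E M p m).indicator (fun w => Ft M w p m) w else 0) := by
      intro p m
      by_cases hpm : p ≠ m
      · simp only [if_pos hpm]; exact (hFtm M p m).indicator (hEm M p m)
      · simp only [if_neg hpm]; exact measurable_const
    calc (M : ℝ≥0∞) * ∫⁻ w, ∑ p, ∑ m, (if p ≠ m then (E M p m).indicator (fun w => Ft M w p m) w else 0) ∂P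
        = (M : ℝ≥0∞) * ∑ p, ∑ m, ∫⁻ w, (if p ≠ m then (E M p m).indicator (fun w => Ft M w p m) w else 0) ∂P := by
          congr 1
          rw [lintegral_finsetSum _ fun p _ => Finset.measurable_sum _ fun m _ => hmeas p m]
          exact Finset.sum_congr rfl fun p _ => lintegral_finsetSum _ fun m _ => hmeas p m
      _ ≤ (M : ℝ≥0∞) * ∑ _p : Fin (N + 1), ∑ _m : Fin (N + 1), ((N + 1 : ℕ) : ℝ≥0∞) * c := by
          gcongr with p _ m _
          by_cases hpm : p ≠ m
          · simp only [if_pos hpm]; exact hterm p m hpm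
          · simp only [if_neg hpm, lintegral_const, zero_mul]; exact bot_le
      _ = ENNReal.ofReal ((M : ℝ) * ((N + 1 : ℕ) : ℝ) ^ 3 * (128 * (hsDiameter σ N) ^ 4 * (τ / M) * (ℓ + τ / M))) * m₂ := by
          simp only [Finset.sum_const, Finset.card_univ, Fintype.card_fin, nsmul_eq_mul]
          rw [hc, ← ENNReal.ofReal_natCast M, ← ENNReal.ofReal_natCast (N + 1), ← mul_assoc, ← mul_assoc, ← mul_assoc,
            ← mul_assoc, ← ENNReal.ofReal_mul (Nat.cast_nonneg _), ← ENNReal.ofReal_mul (by positivity),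
            ← ENNReal.ofReal_mul (by positivity), ← ENNReal.ofReal_mul (by positivity)]
          congr 2
          ring
      _ ≤ ENNReal.ofReal (256 * τ * ℓ * ((N + 1 : ℕ) : ℝ) ^ 3 * (hsDiameter σ N) ^ 4) * m₂ := by
          refine mul_le_mul_of_nonneg_right (ENNReal.ofReal_le_ofReal ?_) bot_le
          have hMτ : (M : ℝ) * (τ / M) = τ := by field_simp
          calc (M : ℝ) * ((N + 1 : ℕ) : ℝ) ^ 3 * (128 * (hsDiameter σ N) ^ 4 * (τ / M) * (ℓ + τ / M))
              = 128 * ((M : ℝ) * (τ / M)) * ((N + 1 : ℕ) : ℝ) ^ 3 * (hsDiameter σ N) ^ 4 * (ℓ + τ / M) := by ring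
            _ ≤ 128 * τ * ((N + 1 : ℕ) : ℝ) ^ 3 * (hsDiameter σ N) ^ 4 * (ℓ + ℓ) := by
                rw [hMτ]; gcongr
            _ = 256 * τ * ℓ * ((N + 1 : ℕ) : ℝ) ^ 3 * (hsDiameter σ N) ^ 4 := by ring
  -- eventually in the mesh, hence frequently
  have hfreq : ∃ᶠ M : ℕ in atTop, (M : ℝ≥0∞) * ∫⁻ w, ∑ p, ∑ m,
      (if p ≠ m then (E M p m).indicator (fun w => Ft M w p m) w else 0) ∂P ≤
        ENNReal.ofReal (256 * τ * ℓ * ((N + 1 : ℕ) : ℝ) ^ 3 * (hsDiameter σ N) ^ 4) * m₂ := by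
    refine Eventually.frequently ?_
    filter_upwards [eventually_ge_atTop (max 1 ⌈τ / ℓ⌉₊)] with M hM
    have hM1 : 1 ≤ M := (le_max_left _ _).trans hM
    have hM2 : τ / ℓ ≤ M := (Nat.le_ceil _).trans (by exact_mod_cast (le_max_right _ _).trans hM)
    refine hB M hM1 ?_
    rw [div_le_iff₀ (by exact_mod_cast hM1 : (0 : ℝ) < M)]
    rw [div_le_iff₀ hℓ] at hM2
    linarith
  exact hgen.trans (liminf_le_of_frequently_le' hfreq)

/-- **Registered sub-goal `fwdHitCollisionSum_lintegral_le_rung0`** (the mean forward-contact bound with all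
binders after the colon; = `localGibbsLaw_lintegral_le_of_le_fwdHitCollisionSum`): for `σ ≤ 1/2`, `a, θ > 0`,
`u`, a flow preserving the homogeneous Gibbs law, the three-label statics, swept tubes and the lift inequality,
`τ, ℓ > 0`, every `f ≥ 0` dominated on the good set by the collision sum of the forward-contact count has
`∫ f dG_N ≤ 256 τ ℓ (N+1)³ ε⁴ · E‖w − v‖²`. [folklore] -/
theorem fwdHitCollisionSum_lintegral_le_rung0 :
    ∀ (σ : ℝ), σ ≤ 1 / 2 → ∀ (a θ : ℝ), 0 < a → 0 < θ → ∀ (u : V3) (N : ℕ)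
    (Φ : HardSphereFlow (Torus.geometry (Fin 3)) (hsDiameter σ N) (N + 1)),
    (∀ t : ℝ, MeasurePreserving (Φ.flow t) (localGibbsLaw σ (fun _ => a) (fun _ => u) (fun _ => θ) N Φ)
      (localGibbsLaw σ (fun _ => a) (fun _ => u) (fun _ => θ) N Φ)) →
    (∀ i j k : Fin (N + 1), i ≠ j → i ≠ k → j ≠ k → ∀ T T₂ : Set T3, MeasurableSet T → MeasurableSet T₂ →
      posGibbsMeasure (fun _ : T3 => (1 : ℝ)) (hsDiameter σ N) (N + 1) {x | x j - x i ∈ T ∧ x k - x i ∈ T₂} ≤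
        8 * (volume T * volume T₂)) →
    (∀ h : ℝ, 0 ≤ h → ∃ S : V3 → Set V3, MeasurableSet {q : V3 × V3 | q.1 ∈ S q.2} ∧
      (∀ u, volume (S u) ≤ ENNReal.ofReal (4 * hsDiameter σ N ^ 2 * h * ‖u‖)) ∧
      ∀ (u r : V3) (s : ℝ), hsDiameter σ N ≤ ‖r‖ → s ∈ Icc 0 h → ‖r + s • u‖ = hsDiameter σ N → r ∈ S u) →
    (∀ B : Set V3, MeasurableSet B →
      volume {x : T3 | ∃ k : Fin 3 → ℤ, Torus.reprSym x + Torus.latticeVec k ∈ B} ≤ volume B) →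
    ∀ τ : ℝ, 0 < τ → ∀ ℓ : ℝ, 0 < ℓ → ∀ f : Config (N + 1) (Fin 3) T3 → ℝ≥0∞,
    (∀ z ∈ Φ.good, f z ≤ ∑ᶠ s ∈ collisionTimes (Torus.geometry (Fin 3)) (hsDiameter σ N)
          (fun t => Φ.flow t z) ∩ Icc 0 τ,
        ∑ i : Fin (N + 1), ∑ j : Fin (N + 1),
          (if i ≠ j ∧ ‖(Torus.geometry (Fin 3)).sepVec (Φ.flow s z i).1 (Φ.flow s z j).1‖ = hsDiameter σ N
            then (∑ k : Fin (N + 1), if k ≠ i ∧ k ≠ j ∧ ∃ t ∈ Ioo 0 ℓ,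
              ‖Torus.reprSym (((Φ.flow s z k).1 - (Φ.flow s z i).1) +
                Torus.proj (t • ((Φ.flow s z k).2 - (Φ.flow s z i).2)))‖ = hsDiameter σ N
              then (1 : ℝ≥0∞) else 0) else 0)) →
    ∫⁻ z, f z ∂(localGibbsLaw σ (fun _ => a) (fun _ => u) (fun _ => θ) N Φ) ≤
      ENNReal.ofReal (256 * τ * ℓ * ((N + 1 : ℕ) : ℝ) ^ 3 * hsDiameter σ N ^ 4) *
        ∫⁻ q, ENNReal.ofReal (‖q.2 - q.1‖ ^ 2) ∂((gaussMeasure u θ).prod (gaussMeasure u θ)) :=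
  fun _ hσ2 _ _ ha hθ u _ Φ hstat htriple htube hlift _ hτ _ hℓ f hf =>
    localGibbsLaw_lintegral_le_of_le_fwdHitCollisionSum hσ2 ha hθ u Φ hstat htriple htube hlift hτ hℓ f hf

end Summit.AtomisticToContinuum.HydrodynamicLimit.Theorems.KickFairRelEquilibriumMesoLine

end
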